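import Mathlib.Analysis.Fourier.Inversion
import Literature.Barriers.AtomisticToContinuum.SutoDegenerateGroundStates
import Literature.NumberTheory.LFunctions.DedekindZetaPoissonProofs
import HarnessLib

/-!
# Sütő 2006, THEOREM (i) (GSC clause): proof of `SutoDegenerateGroundStates`

Companion to `SutoDegenerateGroundStates.lean` (barrier catalogue
`Literature/Barriers/AtomisticToContinuum/`), which vendors the named fact
`Literature.Barriers.AtomisticToContinuum.SutoDegenerateGroundStates` — A. Sütő, *From bcc to fcc:
interplay between oscillating long-range and repulsive short-range forces*, Phys. Rev. B **74**
(2006) 104117 = arXiv:math-ph/0608041, §2 THEOREM (i), clause "`X` is a GSC": for an admissible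
band-limited Fourier-positive pair interaction `φ = 𝓕⁻¹ψ` in `ℝᵈ`, every finite disjoint union of
periodic configurations whose lattices `B_j` satisfy `q_{B_j^*} ≥ K₀` is a ground state
configuration. This file **proves** it: `SutoDegenerateGroundStates_holds`. No new definitions.

## The printed proof (§3.3 of the arXiv version, p. 10, eq. (main)) and its transcription

"Let `X = ∪_j (B_j + y_j)`, `X_f ⊂ X` finite, and let `R` be any finite configuration. … making
use of the definitions, (Poisson-Abel) and the lemma \[the Poisson summation formula,
`∑_{R ∈ B} φ(r + R) = ρ(B) ∑_{K ∈ B^*} φ̂(K) e^{iK·r}`\],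
`U(R|X∖X_f) − U(X_f|X∖X_f) = (N_{X_f} − N_R)[μ + φ(0)/2 − φ̂(0)ρ(X)]`
`+ ∫ φ̂(k) |∑_{r ∈ R} e^{ik·r} − ∑_{x ∈ X_f} e^{ik·x}|² dk/(2(2π)ᵈ)`
`+ ∑_j ρ(B_j) ∑_{0 ≠ K ∈ B_j^*} φ̂(K) e^{−iK·y_j}(∑_{r∈R} e^{iK·r} − ∑_{x∈X_f} e^{iK·x})`.
Suppose now that each `q_{B_j^*} ≥ K₀` … `φ̂` is continuous and takes on zero in all these points
… the last term on its right-hand side vanishes for all `R`. The first term can be made zero … by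
choosing `N_R = N_{X_f}` … Because `φ̂ ≥ 0`, these choices prove that `X` is indeed a GSC."

Lean (Mathlib's convention `φ = Re 𝓕⁻ψ`, `ψ(w) = φ̂(2πw)`, `κ = K₀/2π`; namespace
`Literature.Barriers.AtomisticToContinuum.Suto`):

* *The interaction.* `𝓕⁻ψ` is continuous, bounded by `‖ψ‖₁`, even and real (`ψ` even and real:
  `conj_fourierInv_coe`, `coe_potential`), so the strong temperedness of `φ = Re 𝓕⁻ψ` gives
  `|𝓕⁻ψ(x)| ≤ C(1 + ‖x‖)^{-b}` with `b > d` (`exists_decay`); hence `𝓕⁻ψ ∈ L¹` and, by Mathlib's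
  Fourier inversion (`Continuous.fourier_fourierInv_eq`), `𝓕𝓕⁻ψ = ψ` (`fourier_fourierInv_coe`);
  `ψ = 0` on `‖w‖ ≥ κ` by continuity (`eq_zero_of_le_norm`, the printed "equality is allowed only
  if `φ̂` is continuous at `|k| = K₀`").
* *Each admissible lattice creates a constant field* (the LEMMA, p. 8, in the absolutely convergent
  case): `∑_{g ∈ Γ} φ(r − g) = ψ(0)/covol(Γ)` (`hasSum_potential_lattice`), by the tree's Poisson
  summation formula for lattices in euclidean spaces
  (`Literature.NumberTheory.LFunctions.Fourier.tsum_eq_tsum_fourier_of_rpow_decay`, Neukirch VII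
  (3.2)) applied to `x ↦ 𝓕⁻ψ(r − x)`, whose Fourier transform `e(−⟨r, w⟩)ψ(w)`
  (`fourier_fourierInv_coe_sub`) vanishes at every non-zero dual lattice vector (`‖w‖ ≥ κ`).
  Summing over the motif and over `j` (disjoint unions, `hasSum_sum_disjoint`):
  `∑_{x ∈ X} φ(r − x) = c` is independent of `r` (`hasSum_potential_iUnion`).
* *Fourier positivity* (the middle term of (main)): for real coefficients `c_a` and points `p_a`,
  `∑_{a,b} c_a c_b φ(p_a − p_b) = ∫ ψ(v) |∑_a c_a e^{2πi⟨v, p_a⟩}|² dv ≥ 0`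
  (`sum_sum_mul_potential_nonneg`).
* *Assembly* (`SutoDegenerateGroundStates_holds`): with `S = X_f = range xf`, `N_R = N_{X_f} = N`,
  `I(R, X ∖ S) = Nc − ∑_{i,k} φ(R_i − x_k)` and `U(R) = ½(∑_{i,j} φ(R_i − R_j) − Nφ(0))`, so
  `U(R|X∖S) − U(X_f|X∖S) = ½ ∑_{a,b} s_a s_b φ(p_a − p_b) ≥ 0` for the `2N` points `(R, X_f)` with
  signs `(+1, −1)` — the printed `∫ φ̂ |∑_R e^{ikr} − ∑_{X_f} e^{ikx}|² ≥ 0`.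

## References

* A. Sütő, Phys. Rev. B 74 (2006) 104117 (arXiv:math-ph/0608041): §2 THEOREM (i), LEMMA; §3.1,
  §3.3 (proofs), read in the arXiv version, pp. 5–10.
* A. Sütő, Phys. Rev. Lett. 95 (2005) 265501: THEOREM (i) and its proof.
* J. Neukirch, *Algebraic Number Theory*, Ch. VII (3.2) (Poisson summation, as proved in the tree).
-/

noncomputable section

open scoped RealInnerProductSpace FourierTransform ComplexConjugate
open MeasureTheory Complex Filter Set Literature.Algebra.EuclideanLattices
  Literature.MathematicalPhysics.StatisticalMechanics

namespace Literature.Barriers.AtomisticToContinuum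

namespace Suto

variable {d : ℕ}

/-! ### The interaction `𝓕⁻ψ`: continuity, evenness, realness, decay, Fourier inversion

Throughout, `fun w => (ψ w : ℂ)` is the real function `ψ` on `ℝᵈ = EuclideanSpace ℝ (Fin d)`
viewed as a complex one, so that `potential ψ = Re 𝓕⁻ (fun w => (ψ w : ℂ))`. -/

section Transform

variable {κ : ℝ} {ψ : EuclideanSpace ℝ (Fin d) → ℝ}

/-- `ψ`, viewed as a complex function, is continuous. [folklore] -/
theorem continuous_coe (hc : Continuous ψ) : Continuous (fun w => (ψ w : ℂ)) :=
  continuous_ofReal.comp hc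

/-- A band-limited `ψ` (zero outside the ball of radius `κ`) has compact support. [folklore] -/
theorem hasCompactSupport_coe (h0 : ∀ w, κ < ‖w‖ → ψ w = 0) :
    HasCompactSupport (fun w => (ψ w : ℂ)) := by
  refine HasCompactSupport.intro (isCompact_closedBall (0 : EuclideanSpace ℝ (Fin d)) κ)
    fun w hw => ?_
  have : κ < ‖w‖ := by simpa [Metric.mem_closedBall, dist_zero_right] using hw
  simp [h0 w this]

/-- A continuous band-limited `ψ` is integrable (Sütő: `φ̂ ∈ L¹(ℝᵈ)`). [folklore] -/
theorem integrable_coe (hc : Continuous ψ) (h0 : ∀ w, κ < ‖w‖ → ψ w = 0) :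
    Integrable (fun w => (ψ w : ℂ)) :=
  (continuous_coe hc).integrable_of_hasCompactSupport (hasCompactSupport_coe h0)

/-- By continuity `ψ` vanishes on the sphere `‖w‖ = κ` as well: `ψ(w) = 0` for `‖w‖ ≥ κ` (the
printed "equality is allowed only if `φ̂` is continuous at `|k| = K₀`").
[cite: Suto2006, §2 THEOREM (i)] -/
theorem eq_zero_of_le_norm (hc : Continuous ψ) (hκ : 0 < κ) (h0 : ∀ w, κ < ‖w‖ → ψ w = 0)
    {w : EuclideanSpace ℝ (Fin d)} (hw : κ ≤ ‖w‖) : ψ w = 0 := by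
  have hcl : IsClosed (ψ ⁻¹' {0}) := isClosed_singleton.preimage hc
  have hsub : (Metric.closedBall (0 : EuclideanSpace ℝ (Fin d)) κ)ᶜ ⊆ ψ ⁻¹' {0} := fun x hx =>
    h0 x (by simpa [Metric.mem_closedBall, dist_zero_right] using hx)
  have h := hcl.closure_subset_iff.mpr hsub
  rw [closure_compl, interior_closedBall (0 : EuclideanSpace ℝ (Fin d)) hκ.ne'] at h
  exact h (by simpa [Metric.mem_ball, dist_zero_right] using hw)

/-- `𝓕ψ(w) = 𝓕⁻ψ(−w)`. [folklore] -/
theorem fourier_coe_apply (w : EuclideanSpace ℝ (Fin d)) :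
    𝓕 (fun w => (ψ w : ℂ)) w = 𝓕⁻ (fun w => (ψ w : ℂ)) (-w) := by
  rw [Real.fourierInv_eq_fourier_neg, neg_neg]

/-- `𝓕⁻ψ` is even when `ψ` is (hypothesis (2), `φ̂(−k) = φ̂(k)`).
[cite: Suto2006, §2 THEOREM (2)] -/
theorem fourierInv_coe_neg (he : ∀ w, ψ (-w) = ψ w) (x : EuclideanSpace ℝ (Fin d)) :
    𝓕⁻ (fun w => (ψ w : ℂ)) (-x) = 𝓕⁻ (fun w => (ψ w : ℂ)) x := by
  set A : EuclideanSpace ℝ (Fin d) ≃ₗᵢ[ℝ] EuclideanSpace ℝ (Fin d) := LinearIsometryEquiv.neg ℝ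
    with hA
  have hcomp : (fun w => (ψ w : ℂ)) ∘ A = fun w => (ψ w : ℂ) := by
    funext w
    simp [hA, he]
  calc 𝓕⁻ (fun w => (ψ w : ℂ)) (-x) = 𝓕⁻ (fun w => (ψ w : ℂ)) (A x) := rfl
    _ = 𝓕⁻ ((fun w => (ψ w : ℂ)) ∘ A) x := (Real.fourierInv_comp_linearIsometry A _ x).symm
    _ = 𝓕⁻ (fun w => (ψ w : ℂ)) x := by rw [hcomp]

/-- The potential is even: `φ(−x) = φ(x)` ("`φ(r − r') = φ(r' − r)`"). [cite: Suto2006, §2] -/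
theorem potential_neg (he : ∀ w, ψ (-w) = ψ w) (x : EuclideanSpace ℝ (Fin d)) :
    potential ψ (-x) = potential ψ x := by
  simp only [potential, fourierInv_coe_neg he]

/-- `𝓕⁻ψ` is real for a real even `ψ`: `conj 𝓕⁻ψ = 𝓕⁻ψ`. [folklore] -/
theorem conj_fourierInv_coe (he : ∀ w, ψ (-w) = ψ w) (x : EuclideanSpace ℝ (Fin d)) :
    conj (𝓕⁻ (fun w => (ψ w : ℂ)) x) = 𝓕⁻ (fun w => (ψ w : ℂ)) x := by
  conv_rhs => rw [← fourierInv_coe_neg he x]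
  rw [Real.fourierInv_eq', Real.fourierInv_eq', ← integral_conj]
  refine integral_congr_ae (ae_of_all _ fun v => ?_)
  simp only [smul_eq_mul, map_mul, Complex.conj_ofReal, ← Complex.exp_conj, Complex.conj_I,
    inner_neg_right]
  congr 2
  push_cast
  ring

/-- The potential `φ = Re 𝓕⁻ψ` *is* `𝓕⁻ψ` (which is real). [cite: Suto2006, §2 THEOREM (i)] -/
theorem coe_potential (he : ∀ w, ψ (-w) = ψ w) (x : EuclideanSpace ℝ (Fin d)) :
    (potential ψ x : ℂ) = 𝓕⁻ (fun w => (ψ w : ℂ)) x :=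
  Complex.conj_eq_iff_re.mp (conj_fourierInv_coe he x)

/-- `‖𝓕⁻ψ(x)‖ = |φ(x)|`. [folklore] -/
theorem norm_fourierInv_coe (he : ∀ w, ψ (-w) = ψ w) (x : EuclideanSpace ℝ (Fin d)) :
    ‖𝓕⁻ (fun w => (ψ w : ℂ)) x‖ = |potential ψ x| := by
  rw [← coe_potential he x, Complex.norm_real, Real.norm_eq_abs]

/-- `‖𝓕⁻ψ(x)‖ ≤ ‖ψ‖₁`. [folklore] -/
theorem norm_fourierInv_coe_le (x : EuclideanSpace ℝ (Fin d)) :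
    ‖𝓕⁻ (fun w => (ψ w : ℂ)) x‖ ≤ ∫ v, ‖(ψ v : ℂ)‖ :=
  VectorFourier.norm_fourierIntegral_le_integral_norm 𝐞 volume
    (-innerₗ (EuclideanSpace ℝ (Fin d))) (fun w => (ψ w : ℂ)) x

/-- `𝓕⁻ψ` is continuous ("`φ` is continuous", the Fourier integral of an `L¹` function).
[cite: Suto2006, §2 (before THEOREM)] -/
theorem continuous_fourierInv_coe (hc : Continuous ψ) (h0 : ∀ w, κ < ‖w‖ → ψ w = 0) :
    Continuous (𝓕⁻ (fun w => (ψ w : ℂ))) := by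
  rw [Real.fourierInv_eq_fourier_comp_neg]
  exact VectorFourier.fourierIntegral_continuous Real.continuous_fourierChar
    (innerSL ℝ).continuous₂ ((integrable_coe hc h0).comp_neg)

/-- **Decay of the interaction**: strong temperedness of `φ = Re 𝓕⁻ψ` (`|φ(r)| ≤ C r^{-d-η}` for
`r > r'`, Remark 6) and the bound `|𝓕⁻ψ| ≤ ‖ψ‖₁` give `|𝓕⁻ψ(x)| ≤ C'(1 + ‖x‖)^{-b}` on all of
`ℝᵈ`, with `b = d + η > d`. [cite: Suto2006, §2 Remark 6] -/
theorem exists_decay (he : ∀ w, ψ (-w) = ψ w) (hT : IsStronglyTempered (potential ψ)) :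
    ∃ C b : ℝ, (d : ℝ) < b ∧
      ∀ x : EuclideanSpace ℝ (Fin d), ‖𝓕⁻ (fun w => (ψ w : ℂ)) x‖ ≤ C * (1 + ‖x‖) ^ (-b) := by
  obtain ⟨C, η, r₀, hC, hη, hr₀, hdec⟩ := hT
  set M : ℝ := ∫ v : EuclideanSpace ℝ (Fin d), ‖(ψ v : ℂ)‖ with hM
  have hM0 : 0 ≤ M := integral_nonneg fun _ => norm_nonneg _
  set b : ℝ := (d : ℝ) + η with hb
  have hb0 : 0 ≤ b := by positivity
  refine ⟨M * (1 + r₀) ^ b + C * ((1 + r₀) / r₀) ^ b, b, by linarith, fun x => ?_⟩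
  have h1 : 0 < 1 + ‖x‖ := by positivity
  have hA : 0 ≤ M * (1 + r₀) ^ b * (1 + ‖x‖) ^ (-b) := by positivity
  have hB : 0 ≤ C * ((1 + r₀) / r₀) ^ b * (1 + ‖x‖) ^ (-b) := by positivity
  rcases le_or_gt ‖x‖ r₀ with hx | hx
  · -- near the origin: `‖𝓕⁻ψ(x)‖ ≤ M ≤ M (1 + r₀)^b (1 + ‖x‖)^{-b}`
    have hFx : ‖𝓕⁻ (fun w => (ψ w : ℂ)) x‖ ≤ M := norm_fourierInv_coe_le x
    have hcmp : 1 ≤ (1 + r₀) ^ b * (1 + ‖x‖) ^ (-b) := by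
      have hpow : (1 + ‖x‖) ^ b ≤ (1 + r₀) ^ b := Real.rpow_le_rpow h1.le (by linarith) hb0
      have hpos : 0 < (1 + ‖x‖) ^ b := Real.rpow_pos_of_pos h1 b
      rw [Real.rpow_neg h1.le, ← div_eq_mul_inv, le_div_iff₀ hpos, one_mul]
      exact hpow
    calc ‖𝓕⁻ (fun w => (ψ w : ℂ)) x‖ ≤ M * 1 := by rw [mul_one]; exact hFx
      _ ≤ M * ((1 + r₀) ^ b * (1 + ‖x‖) ^ (-b)) := mul_le_mul_of_nonneg_left hcmp hM0
      _ ≤ (M * (1 + r₀) ^ b + C * ((1 + r₀) / r₀) ^ b) * (1 + ‖x‖) ^ (-b) := by nlinarith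
  · -- far from the origin: `|φ(x)| ≤ C ‖x‖^{-b} ≤ C ((1 + r₀)/r₀)^b (1 + ‖x‖)^{-b}`
    have hFx : ‖𝓕⁻ (fun w => (ψ w : ℂ)) x‖ ≤ C * ‖x‖ ^ (-b) := by
      rw [norm_fourierInv_coe he x]
      exact hdec x hx
    have hq : 0 < (1 + r₀) / r₀ := by positivity
    have hle : (1 + ‖x‖) / ((1 + r₀) / r₀) ≤ ‖x‖ := by
      rw [div_div_eq_mul_div, div_le_iff₀ (by positivity : (0 : ℝ) < 1 + r₀)]
      nlinarith [hx.le]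
    have hpos : 0 < (1 + ‖x‖) / ((1 + r₀) / r₀) := by positivity
    have hcmp : ‖x‖ ^ (-b) ≤ ((1 + r₀) / r₀) ^ b * (1 + ‖x‖) ^ (-b) := by
      calc ‖x‖ ^ (-b) ≤ ((1 + ‖x‖) / ((1 + r₀) / r₀)) ^ (-b) :=
            Real.rpow_le_rpow_of_nonpos hpos hle (by linarith)
        _ = ((1 + r₀) / r₀) ^ b * (1 + ‖x‖) ^ (-b) := by
            rw [Real.div_rpow h1.le hq.le, Real.rpow_neg hq.le, div_inv_eq_mul, mul_comm]
    calc ‖𝓕⁻ (fun w => (ψ w : ℂ)) x‖ ≤ C * ‖x‖ ^ (-b) := hFx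
      _ ≤ C * (((1 + r₀) / r₀) ^ b * (1 + ‖x‖) ^ (-b)) := mul_le_mul_of_nonneg_left hcmp hC.le
      _ ≤ (M * (1 + r₀) ^ b + C * ((1 + r₀) / r₀) ^ b) * (1 + ‖x‖) ^ (-b) := by nlinarith

/-- `𝓕⁻ψ ∈ L¹(ℝᵈ)` (from the decay). [folklore] -/
theorem integrable_fourierInv_coe (hc : Continuous ψ) (h0 : ∀ w, κ < ‖w‖ → ψ w = 0)
    (he : ∀ w, ψ (-w) = ψ w) (hT : IsStronglyTempered (potential ψ)) :
    Integrable (𝓕⁻ (fun w => (ψ w : ℂ))) := by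
  obtain ⟨C, b, hb, hdec⟩ := exists_decay he hT
  exact Literature.NumberTheory.LFunctions.Fourier.integrable_of_decay
    (continuous_fourierInv_coe hc h0) (by rwa [finrank_euclideanSpace_fin]) hdec

/-- **Fourier inversion** `𝓕𝓕⁻ψ = ψ` (Mathlib `Continuous.fourier_fourierInv_eq`: `ψ` continuous
and integrable, `𝓕ψ = 𝓕⁻ψ(−·)` integrable). [folklore] -/
theorem fourier_fourierInv_coe (hc : Continuous ψ) (h0 : ∀ w, κ < ‖w‖ → ψ w = 0)
    (he : ∀ w, ψ (-w) = ψ w) (hT : IsStronglyTempered (potential ψ)) :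
    𝓕 (𝓕⁻ (fun w => (ψ w : ℂ))) = fun w => (ψ w : ℂ) := by
  refine (continuous_coe hc).fourier_fourierInv_eq (integrable_coe hc h0) ?_
  have : 𝓕 (fun w => (ψ w : ℂ)) = fun w => 𝓕⁻ (fun w => (ψ w : ℂ)) (-w) :=
    funext fun w => fourier_coe_apply w
  rw [this]
  exact (integrable_fourierInv_coe hc h0 he hT).comp_neg

/-- `𝓕⁻𝓕⁻ψ = ψ` for the even `ψ`. [folklore] -/
theorem fourierInv_fourierInv_coe (hc : Continuous ψ) (h0 : ∀ w, κ < ‖w‖ → ψ w = 0)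
    (he : ∀ w, ψ (-w) = ψ w) (hT : IsStronglyTempered (potential ψ))
    (w : EuclideanSpace ℝ (Fin d)) : 𝓕⁻ (𝓕⁻ (fun w => (ψ w : ℂ))) w = (ψ w : ℂ) := by
  rw [Real.fourierInv_eq_fourier_neg, fourier_fourierInv_coe hc h0 he hT]
  simp [he]

/-- **The Fourier transform of the reflected translate** `x ↦ 𝓕⁻ψ(r − x)` is
`w ↦ e(−⟨r, w⟩) ψ(w)` (translation rule and Fourier inversion). [folklore] -/
theorem fourier_fourierInv_coe_sub (hc : Continuous ψ) (h0 : ∀ w, κ < ‖w‖ → ψ w = 0)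
    (he : ∀ w, ψ (-w) = ψ w) (hT : IsStronglyTempered (potential ψ))
    (r w : EuclideanSpace ℝ (Fin d)) :
    𝓕 (fun x => 𝓕⁻ (fun w => (ψ w : ℂ)) (r - x)) w = 𝐞 (-⟪r, w⟫) • (ψ w : ℂ) := by
  set F : EuclideanSpace ℝ (Fin d) → ℂ := 𝓕⁻ (fun w => (ψ w : ℂ)) with hF
  have hfun : (fun x => F (r - x)) = (fun x => F (-x)) ∘ fun v => v + -r := by
    funext x
    simp only [Function.comp_apply]
    congr 1
    abel
  rw [hfun]
  change VectorFourier.fourierIntegral 𝐞 volume (innerₗ (EuclideanSpace ℝ (Fin d)))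
    ((fun x => F (-x)) ∘ fun v => v + -r) w = _
  rw [VectorFourier.fourierIntegral_comp_add_right]
  simp only [innerₗ_apply_apply, inner_neg_left]
  congr 1
  change 𝓕 (fun x => F (-x)) w = _
  rw [← Real.fourierInv_eq_fourier_comp_neg, hF, fourierInv_fourierInv_coe hc h0 he hT]

/-- Polynomial decay is stable under `x ↦ r − x` (constant multiplied by `(1 + ‖r‖)^b`).
[folklore] -/
theorem decay_sub {F : EuclideanSpace ℝ (Fin d) → ℂ} {C b : ℝ} (hb : 0 ≤ b)
    (hdec : ∀ x, ‖F x‖ ≤ C * (1 + ‖x‖) ^ (-b)) (r x : EuclideanSpace ℝ (Fin d)) :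
    ‖F (r - x)‖ ≤ C * (1 + ‖r‖) ^ b * (1 + ‖x‖) ^ (-b) := by
  have hC : 0 ≤ C := Literature.NumberTheory.LFunctions.Fourier.decayConst_nonneg hdec
  have h1 : 0 < 1 + ‖x‖ := by positivity
  have h2 : 0 < 1 + ‖r‖ := by positivity
  have hkey : (1 + ‖x‖) / (1 + ‖r‖) ≤ 1 + ‖r - x‖ := by
    rw [div_le_iff₀ h2]
    have : ‖x‖ ≤ ‖r‖ + ‖r - x‖ := by
      calc ‖x‖ = ‖r - (r - x)‖ := by rw [sub_sub_cancel]
        _ ≤ ‖r‖ + ‖r - x‖ := norm_sub_le _ _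
    nlinarith [norm_nonneg (r - x), norm_nonneg r]
  have hpos : 0 < (1 + ‖x‖) / (1 + ‖r‖) := by positivity
  calc ‖F (r - x)‖ ≤ C * (1 + ‖r - x‖) ^ (-b) := hdec _
    _ ≤ C * ((1 + ‖x‖) / (1 + ‖r‖)) ^ (-b) :=
        mul_le_mul_of_nonneg_left (Real.rpow_le_rpow_of_nonpos hpos hkey (by linarith)) hC
    _ = C * (1 + ‖r‖) ^ b * (1 + ‖x‖) ^ (-b) := by
        rw [Real.div_rpow h1.le h2.le, Real.rpow_neg h2.le, div_inv_eq_mul]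
        ring

end Transform

/-! ### Each admissible lattice creates a constant field (Poisson summation) -/

section Lattice

variable {κ : ℝ} {ψ : EuclideanSpace ℝ (Fin d) → ℝ}

/-- **The LEMMA of Sütő 2006 in the absolutely convergent case: a sufficiently dense lattice
creates a constant field.** For admissible `(κ, ψ)` and a full lattice `Γ` all of whose non-zero
dual vectors have norm `≥ κ`, `∑_{g ∈ Γ} φ(r − g) = ψ(0)/covol(Γ)` for every `r` (printed:
`∑_{R ∈ B} φ(r + R) = ρ(B) ∑_{K ∈ B^*} φ̂(K) e^{iK·r} = ρ(B) φ̂(0)`), the series converging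
absolutely. Poisson summation (tree: `tsum_eq_tsum_fourier_of_rpow_decay`, Neukirch VII (3.2))
for `x ↦ 𝓕⁻ψ(r − x)`, whose Fourier transform `e(−⟨r,w⟩)ψ(w)` vanishes on `Γ^* ∖ {0}`.
[cite: Suto2006, §2 LEMMA and §3.3] -/
theorem hasSum_potential_lattice (hψ : IsAdmissible κ ψ)
    (Γ : Submodule ℤ (EuclideanSpace ℝ (Fin d))) [DiscreteTopology Γ] [IsZLattice ℝ Γ]
    (hΓ : DualVectorsAtLeast κ Γ) (r : EuclideanSpace ℝ (Fin d)) :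
    HasSum (fun g : Γ => potential ψ (r - g)) (ψ 0 / ZLattice.covolume Γ) := by
  obtain ⟨C, b, hb, hdec⟩ := exists_decay hψ.even hψ.tempered
  have hb0 : 0 ≤ b := le_trans (Nat.cast_nonneg d) hb.le
  set F : EuclideanSpace ℝ (Fin d) → ℂ := 𝓕⁻ (fun w => (ψ w : ℂ)) with hF
  set f : EuclideanSpace ℝ (Fin d) → ℂ := fun x => F (r - x) with hf
  have hfc : Continuous f :=
    (continuous_fourierInv_coe hψ.continuous hψ.eq_zero).comp (continuous_const.sub continuous_id)
  have hfdec : ∀ x, ‖f x‖ ≤ C * (1 + ‖r‖) ^ b * (1 + ‖x‖) ^ (-b) := decay_sub hb0 hdec r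
  have hbV : (Module.finrank ℝ (EuclideanSpace ℝ (Fin d)) : ℝ) < b := by
    rwa [finrank_euclideanSpace_fin]
  -- the Fourier transform of `f` vanishes on the dual lattice off the origin
  have hFf : ∀ w, 𝓕 f w = 𝐞 (-⟪r, w⟫) • (ψ w : ℂ) :=
    fourier_fourierInv_coe_sub hψ.continuous hψ.eq_zero hψ.even hψ.tempered r
  have hvan : ∀ g' : dualLattice Γ, g' ≠ 0 → 𝓕 f g' = 0 := by
    intro g' hg'
    have hne : (g' : EuclideanSpace ℝ (Fin d)) ≠ 0 := fun h => hg' (Submodule.coe_eq_zero.mp h)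
    have hz : ψ g' = 0 :=
      eq_zero_of_le_norm hψ.continuous hψ.pos hψ.eq_zero (hΓ g' g'.2 hne)
    rw [hFf, hz]
    simp
  have hzero : 𝓕 f ((0 : dualLattice Γ) : EuclideanSpace ℝ (Fin d)) = (ψ 0 : ℂ) := by
    rw [hFf]
    simp
  have hsum : Summable fun g' : dualLattice Γ => 𝓕 f g' :=
    summable_of_ne_finset_zero (s := {0}) fun g' hg' => hvan g' (by simpa using hg')
  have htsum : ∑' g' : dualLattice Γ, 𝓕 f g' = (ψ 0 : ℂ) := by
    rw [tsum_eq_single 0 fun g' hg' => hvan g' hg']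
    exact hzero
  -- Poisson summation over `Γ`
  have key := Literature.NumberTheory.LFunctions.Fourier.tsum_eq_tsum_fourier_of_rpow_decay Γ
    hfc hbV hfdec hsum
  rw [htsum] at key
  have hsumΓ : Summable fun g : Γ => f g :=
    Literature.NumberTheory.LFunctions.Fourier.summable_of_decay_zlattice Γ hbV hfdec
  have hCx : HasSum (fun g : Γ => f g) (((ZLattice.covolume Γ)⁻¹ : ℝ) • (ψ 0 : ℂ)) := by
    rw [← key]
    exact hsumΓ.hasSum
  -- real parts
  have hR := Complex.hasSum_re hCx
  simp only [hf, Complex.smul_re, Complex.ofReal_re, smul_eq_mul] at hR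
  rw [div_eq_inv_mul]
  exact hR

end Lattice

/-! ### Periodic configurations and their finite disjoint unions -/

section Configurations

variable {κ : ℝ} {ψ : EuclideanSpace ℝ (Fin d) → ℝ}

/-- The point set `F + Γ` of a periodic configuration is the union over the motif of the
translates `y + Γ`. [folklore] -/
theorem points_eq_biUnion (P : PeriodicConfiguration d) :
    P.points = ⋃ y ∈ P.motif,
      Set.range (fun g : P.lattice => y + (g : EuclideanSpace ℝ (Fin d))) := by
  ext z
  simp only [PeriodicConfiguration.points, Set.mem_setOf_eq, Set.mem_iUnion, Set.mem_range,
    Subtype.exists, exists_prop]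
  constructor
  · rintro ⟨y, hy, g, hg, rfl⟩
    exact ⟨y, hy, g, hg, rfl⟩
  · rintro ⟨y, hy, g, hg, rfl⟩
    exact ⟨y, hy, g, hg, rfl⟩

/-- Distinct motif points give disjoint translates (motif points are inequivalent mod `Γ`).
[folklore] -/
theorem pairwiseDisjoint_translates (P : PeriodicConfiguration d) :
    (P.motif : Set (EuclideanSpace ℝ (Fin d))).Pairwise (Function.onFun Disjoint
      fun y => Set.range (fun g : P.lattice => y + (g : EuclideanSpace ℝ (Fin d)))) := by
  intro y hy y' hy' hne
  rw [Function.onFun_apply, Set.disjoint_left]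
  rintro z ⟨g, rfl⟩ ⟨g', hg'⟩
  apply hne
  refine P.eq_of_sub_mem y hy y' hy' ?_
  have : y - y' = (g' : EuclideanSpace ℝ (Fin d)) - g := by
    rw [sub_eq_sub_iff_add_eq_add, add_comm (g' : EuclideanSpace ℝ (Fin d)) y']
    exact hg'.symm
  rw [this]
  exact P.lattice.sub_mem g'.2 g.2

/-- **A sufficiently dense periodic configuration creates a constant field**:
`∑_{x ∈ F + Γ} φ(r − x) = #F · ψ(0)/covol(Γ)` for every `r` (the lattice statement summed over
the motif, the translates being disjoint). [cite: Suto2006, §3.3 (I(x, X) = ρ(X) φ̂(0))] -/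
theorem hasSum_potential_periodic (hψ : IsAdmissible κ ψ) (P : PeriodicConfiguration d)
    (hP : DualVectorsAtLeast κ P.lattice) (r : EuclideanSpace ℝ (Fin d)) :
    HasSum (fun x : P.points => potential ψ (r - x))
      (P.motif.card * (ψ 0 / ZLattice.covolume P.lattice)) := by
  rw [points_eq_biUnion P, ← nsmul_eq_mul, ← Finset.sum_const]
  change HasSum ((fun z : EuclideanSpace ℝ (Fin d) => potential ψ (r - z)) ∘ (↑) :
    (⋃ y ∈ P.motif, Set.range (fun g : P.lattice => y + (g : EuclideanSpace ℝ (Fin d)))) → ℝ) _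
  refine hasSum_sum_disjoint P.motif (f := fun z : EuclideanSpace ℝ (Fin d) => potential ψ (r - z))
    (pairwiseDisjoint_translates P) fun y _ => ?_
  have hinj : Function.Injective (fun g : P.lattice => y + (g : EuclideanSpace ℝ (Fin d))) :=
    fun a b h => Subtype.ext (add_left_cancel h)
  refine (hinj.hasSum_range_iff
    (f := fun z : EuclideanSpace ℝ (Fin d) => potential ψ (r - z))).mpr ?_
  have hfg : ((fun z : EuclideanSpace ℝ (Fin d) => potential ψ (r - z)) ∘
      fun g : P.lattice => y + (g : EuclideanSpace ℝ (Fin d))) =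
        fun g : P.lattice => potential ψ (r - y - g) := by
    funext g
    simp only [Function.comp_apply, sub_add_eq_sub_sub]
  rw [hfg]
  exact hasSum_potential_lattice hψ P.lattice hP (r - y)

/-- **A finite disjoint union of sufficiently dense periodic configurations creates a constant
field** `∑_{x ∈ X} φ(r − x) = ∑_j #F_j ψ(0)/covol(Γ_j)`, independent of `r` (printed:
`I(r, X) = ∑_j I(r − y_j, B_j)` and `I(x, X) = ρ(X) φ̂(0)`).
[cite: Suto2006, §2 (I(r,X)) and §3.3] -/
theorem hasSum_potential_iUnion (hψ : IsAdmissible κ ψ) {J : ℕ}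
    (P : Fin J → PeriodicConfiguration d) (hP : ∀ j, DualVectorsAtLeast κ (P j).lattice)
    (hdisj : Pairwise fun i j => Disjoint (P i).points (P j).points)
    (r : EuclideanSpace ℝ (Fin d)) :
    HasSum (fun x : ↥(⋃ j, (P j).points) => potential ψ (r - x))
      (∑ j, ((P j).motif.card * (ψ 0 / ZLattice.covolume (P j).lattice))) := by
  have hset : (⋃ j, (P j).points) = ⋃ j ∈ (Finset.univ : Finset (Fin J)), (P j).points := by
    simp
  rw [hset]
  change HasSum ((fun z : EuclideanSpace ℝ (Fin d) => potential ψ (r - z)) ∘ (↑) :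
    (⋃ j ∈ (Finset.univ : Finset (Fin J)), (P j).points) → ℝ) _
  refine hasSum_sum_disjoint (Finset.univ : Finset (Fin J))
    (f := fun z : EuclideanSpace ℝ (Fin d) => potential ψ (r - z))
    (fun i _ j _ hij => hdisj hij) fun j _ => ?_
  exact hasSum_potential_periodic hψ (P j) (hP j) r

end Configurations

/-! ### Fourier positivity -/

section Positivity

variable {κ : ℝ} {ψ : EuclideanSpace ℝ (Fin d) → ℝ}

/-- **Fourier positivity of the interaction** (the middle term of eq. (main)): for real
coefficients `c_a` and points `p_a`,
`∑_{a,b} c_a c_b φ(p_a − p_b) = ∫ ψ(v) |∑_a c_a e^{2πi⟨v, p_a⟩}|² dv ≥ 0` because `ψ ≥ 0`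
(printed: `∫ φ̂(k) |∑_{r∈R} e^{ik·r} − ∑_{x∈X_f} e^{ik·x}|² dk/(2(2π)ᵈ)`).
[cite: Suto2006, §3.3 eq. (main)] [cite: SutoPRL2005, proof of THEOREM (i)] -/
theorem sum_sum_mul_potential_nonneg (hψ : IsAdmissible κ ψ) {ι : Type*} [Fintype ι]
    (c : ι → ℝ) (p : ι → EuclideanSpace ℝ (Fin d)) :
    0 ≤ ∑ a, ∑ b, c a * c b * potential ψ (p a - p b) := by
  -- the characters `e(v, x) = exp(2πi⟨v, x⟩)`
  set e : EuclideanSpace ℝ (Fin d) → EuclideanSpace ℝ (Fin d) → ℂ :=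
    fun v x => cexp (↑(2 * Real.pi * ⟪v, x⟫) * I) with he
  have henorm : ∀ v x, ‖e v x‖ = 1 := fun v x => by
    rw [he]
    exact Complex.norm_exp_ofReal_mul_I _
  have hecont : ∀ x, Continuous fun v => e v x := fun x => by
    rw [he]
    fun_prop
  have hint : ∀ x, Integrable fun v => e v x * (ψ v : ℂ) := fun x =>
    (integrable_coe hψ.continuous hψ.eq_zero).bdd_mul (hecont x).aestronglyMeasurable
      (ae_of_all _ fun v => (henorm v x).le)
  have he_sub : ∀ v x y, e v (x - y) = e v x * conj (e v y) := by
    intro v x y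
    simp only [he, inner_sub_right, ← Complex.exp_conj, map_mul, Complex.conj_ofReal,
      Complex.conj_I, ← Complex.exp_add]
    congr 1
    push_cast
    ring
  -- each term as a Fourier integral
  have hF : ∀ x, (potential ψ x : ℂ) = ∫ v, e v x * (ψ v : ℂ) := fun x => by
    rw [coe_potential hψ.even, Real.fourierInv_eq']
    simp only [smul_eq_mul, he]
  -- linearity of the integral
  have step1 : (∫ v, ∑ a, ∑ b, (c a : ℂ) * (c b : ℂ) * (e v (p a - p b) * (ψ v : ℂ))) =
      ∑ a, ∑ b, (c a : ℂ) * (c b : ℂ) * ∫ v, e v (p a - p b) * (ψ v : ℂ) := by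
    rw [integral_finsetSum _ (fun a _ => ?_)]
    · refine Finset.sum_congr rfl fun a _ => ?_
      rw [integral_finsetSum _ (fun b _ => ?_)]
      · refine Finset.sum_congr rfl fun b _ => ?_
        exact integral_const_mul _ _
      · exact (hint _).const_mul _
    · exact integrable_finsetSum _ fun b _ => (hint _).const_mul _
  -- the integrand is `ψ(v) |∑ c_a e(v, p_a)|²`
  have step2 : ∀ v, ∑ a, ∑ b, (c a : ℂ) * (c b : ℂ) * (e v (p a - p b) * (ψ v : ℂ)) =
      ((ψ v * Complex.normSq (∑ a, (c a : ℂ) * e v (p a)) : ℝ) : ℂ) := by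
    intro v
    push_cast
    rw [← Complex.mul_conj, map_sum, Finset.sum_mul_sum, Finset.mul_sum]
    refine Finset.sum_congr rfl fun a _ => ?_
    rw [Finset.mul_sum]
    refine Finset.sum_congr rfl fun b _ => ?_
    rw [he_sub, map_mul, Complex.conj_ofReal]
    ring
  have hS : ((∑ a, ∑ b, c a * c b * potential ψ (p a - p b) : ℝ) : ℂ) =
      ((∫ v, ψ v * Complex.normSq (∑ a, (c a : ℂ) * e v (p a)) : ℝ) : ℂ) := by
    push_cast
    simp_rw [hF]
    rw [← step1, ← integral_complex_ofReal]
    exact integral_congr_ae (ae_of_all _ fun v => step2 v)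
  rw [Complex.ofReal_injective hS]
  exact integral_nonneg fun v => mul_nonneg (hψ.nonneg v) (Complex.normSq_nonneg _)

end Positivity

end Suto

/-! ### Assembly: Sütő 2006, THEOREM (i), clause "`X` is a GSC" -/

open Suto in
/-- **Sütő 2006, THEOREM (i) (GSC clause) — discharge of the named fact
`SutoDegenerateGroundStates`.** For `d ≥ 1` and admissible `(κ, ψ)`, every finite union of
periodic configurations with pairwise disjoint point sets whose lattices have all non-zero dual
vectors of norm `≥ κ` is a ground state configuration of `φ = Re 𝓕⁻ψ`: the field of `X` is a
constant `c` (`Suto.hasSum_potential_iUnion`), so for `N_R = N_{X_f} = N`,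
`U(R|X∖X_f) − U(X_f|X∖X_f) = ½ ∑_{a,b} s_a s_b φ(p_a − p_b) ≥ 0` over the `2N` signed points
`(R, +1), (X_f, −1)` (`Suto.sum_sum_mul_potential_nonneg`), which is eq. (main) of the source with
its first and last terms equal to zero. [cite: Suto2006, §2 THEOREM (i) and §3.3]
[cite: SutoPRL2005, THEOREM (i)] -/
theorem SutoDegenerateGroundStates_holds : SutoDegenerateGroundStates := by
  intro d hd κ ψ hψ J P hP hdisj
  set X : Set (EuclideanSpace ℝ (Fin d)) := ⋃ j, (P j).points with hX
  set c : ℝ := ∑ j, ((P j).motif.card * (ψ 0 / ZLattice.covolume (P j).lattice)) with hc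
  have hfield : ∀ r, HasSum (fun x : X => potential ψ (r - x)) c := fun r =>
    hasSum_potential_iUnion hψ P hP hdisj r
  refine ⟨fun r => (hfield r).summable, ?_⟩
  intro N xf hxf hS R
  -- the field of `X ∖ X_f` at a point `r` is `c − ∑_k φ(r − x_k)`
  have htail : ∀ r, ∑' x : ↥(X \ Set.range xf), potential ψ (r - x) =
      c - ∑ k, potential ψ (r - xf k) := by
    intro r
    have h1 : HasSum (fun x : Set.range xf => potential ψ (r - x))
        (∑ k, potential ψ (r - xf k)) :=
      (hxf.hasSum_range_iff (f := fun z => potential ψ (r - z))).mpr (hasSum_fintype _)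
    have h2 : Summable (fun x : ↥(X \ Set.range xf) => potential ψ (r - x)) :=
      (hfield r).summable.comp_injective (i := Set.inclusion Set.sdiff_subset)
        (Set.inclusion_injective (Set.sdiff_subset : X \ Set.range xf ⊆ X))
    have h3 := HasSum.add_disjoint (f := fun z => potential ψ (r - z)) Set.disjoint_sdiff_left
      h2.hasSum h1
    rw [Set.sdiff_union_of_subset hS] at h3
    have h4 := (hfield r).unique h3
    linarith
  -- the interactions with `X ∖ X_f`
  have hIR : interaction (potential ψ) R (X \ Set.range xf) =
      N * c - ∑ i, ∑ k, potential ψ (R i - xf k) := by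
    simp only [interaction, htail]
    rw [Finset.sum_sub_distrib, Finset.sum_const, Finset.card_univ, Fintype.card_fin,
      nsmul_eq_mul]
  have hIX : interaction (potential ψ) xf (X \ Set.range xf) =
      N * c - ∑ i, ∑ k, potential ψ (xf i - xf k) := by
    simp only [interaction, htail]
    rw [Finset.sum_sub_distrib, Finset.sum_const, Finset.card_univ, Fintype.card_fin,
      nsmul_eq_mul]
  -- the energies, with the diagonal added back
  have hfilter : ∀ i : Fin N, (Finset.univ.filter fun j => j ≠ i) = Finset.univ.erase i := by
    intro i
    ext j
    simp [Finset.mem_erase]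
  have hE : ∀ Q : Fin N → EuclideanSpace ℝ (Fin d), energy (potential ψ) Q =
      1 / 2 * (∑ i, ∑ j, potential ψ (Q i - Q j) - N * potential ψ 0) := by
    intro Q
    have hin : ∀ i, ∑ j ∈ Finset.univ.filter (fun j => j ≠ i), potential ψ (Q i - Q j) =
        ∑ j, potential ψ (Q i - Q j) - potential ψ 0 := by
      intro i
      rw [hfilter, Finset.sum_erase_eq_sub (Finset.mem_univ i), sub_self]
    unfold energy
    rw [Finset.sum_congr rfl fun i _ => hin i, Finset.sum_sub_distrib, Finset.sum_const,
      Finset.card_univ, Fintype.card_fin, nsmul_eq_mul]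
  -- Fourier positivity on the `2N` signed points `(R, +1), (X_f, −1)`
  have hQ := sum_sum_mul_potential_nonneg hψ
    (Sum.elim (fun _ : Fin N => (1 : ℝ)) (fun _ : Fin N => (-1 : ℝ))) (Sum.elim R xf)
  simp only [Fintype.sum_sum_type, Sum.elim_inl, Sum.elim_inr, one_mul, mul_one, neg_mul,
    mul_neg, Finset.sum_neg_distrib, Finset.sum_add_distrib] at hQ
  have hsymm : ∑ k, ∑ i, potential ψ (xf k - R i) = ∑ i, ∑ k, potential ψ (R i - xf k) := by
    rw [Finset.sum_comm]
    refine Finset.sum_congr rfl fun i _ => Finset.sum_congr rfl fun k _ => ?_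
    rw [← potential_neg hψ.even, neg_sub]
  rw [hE xf, hE R, hIR, hIX]
  linarith

end Literature.Barriers.AtomisticToContinuum

end
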